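import Literature.IUT.LogVolume.DyadicPrimeResidueEmbeddingOrder
import HarnessLib

/-!
# Mixed tensor packets: isometries at GOOD slots never move `(R_I)^∼`, whatever the other slot fields are

Classical local algebra (nothing disputed).  [IUTchIV] Prop. 1.1 p. 9 attaches to a tensor packet `V = ⊗_{ℚ_p} k_i` over an
ARBITRARY finite family `{k_i}_{i ∈ I}` of `p`-adic fields (the slot fields need not coincide) the maximal `ℤ_p`-order `(R_I)^∼`
(the tree's `normalizedPacket`).  abc-iut-E-t42's embedding-order criterion
(`EmbeddingOrder.congr_image_normalizedPacket_of_embeddingOrder`) is SLOT-BY-SLOT: it asks, at each slot, for an integral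
embedding-order representation `ι ∘ g_i = Σ_τ c_τ·τ` of `g_i` and of `g_i⁻¹`.  The identity has one trivially (`ι = 1·ι`); TAME slots
(`Tr(𝒪) = ℤ_p`, E-t42's `exists_embeddingOrder_repr_of_isometry_of_not_wild`) and slots on the RESIDUAL DYADIC CLASS (units `≡ 1`,
`d ≤ e`; abc-iut-E-cx-2's `DyadicPrimeResidue.exists_embeddingOrder_repr_of_isometry`) supply one for every `ℚ_p`-linear isometry.
Hence (`congr_image_normalizedPacket_eq_of_refl_or_good`): **if at every slot either `g_i = 1` or the slot field is tame or residual
dyadic, then `(⊗_i g_i)((R_I)^∼) = (R_I)^∼`** — the slot fields at the identity slots are ARBITRARY (wild, any degree).  In particular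
(`not_exists_mover_at_refl_or_good`) a factorwise-isometric MOVER of `(R_I)^∼` in a MIXED packet must act non-trivially at some slot
whose field is neither tame nor residual dyadic: good slots never move a packet, whatever they are tensored with.  This is the per-slot
form of `DyadicPrimeResidue.congr_image_normalizedPacket_eq_of_tame_or_primeResidue` (which assumes EVERY slot good).
Which BAD-slot isometries move which mixed packets is NOT a per-slot question (abc-iut-E-t7 g7 exact table,
HOME/staging/E/t7/g7/MIXED-PACKET-DATUM.md: `ℚ₂(√2) ⊗ ℚ₂(√−2)` is stable, `ℚ₂(√2) ⊗ ℚ₂(√10)` and `ℚ₂(ζ₈) ⊗ ℚ₂(√−1)` are moved).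
Statement about CONTAINERS only; no side taken on [IUTchIII] Cor. 3.12.  PROOF-ONLY file (theorems, no definitions, no `Prop` facts).
[cite: Mochizuki2012, IUTchIV Prop. 1.1 p. 9] [cite: SerreLocalFields1979, Ch. III §3, Prop. 7] [cite: NeukirchANT1999, Ch. II (4.8)]
-/

noncomputable section

open Module

namespace Literature.IUT.LogVolume

namespace MixedPacket

variable (p : ℕ) [Fact p.Prime]
variable {I : Type} [Fintype I] [DecidableEq I] [Nonempty I]
variable (k : I → Type) [∀ i, NontriviallyNormedField (k i)] [∀ i, NormedAlgebra ℚ_[p] (k i)] [∀ i, IsUltrametricDist (k i)]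
  [∀ i, ProperSpace (k i)]

omit [Fintype I] [DecidableEq I] [Nonempty I] in
/-- The identity of a slot field is an integral embedding-order element: `ι ∘ 1 = 1·ι`. [cite: Mochizuki2012, IUTchIV Prop. 1.1 p. 9] -/
theorem exists_embeddingOrder_repr_refl (i : I) :
    ∃ (ι : k i →ₐ[ℚ_[p]] PadicAlgCl p) (T : Finset (k i →ₐ[ℚ_[p]] PadicAlgCl p))
      (c : (k i →ₐ[ℚ_[p]] PadicAlgCl p) → PadicAlgCl p), (∀ τ ∈ T, ‖c τ‖ ≤ 1) ∧
        ∀ x, ι ((LinearEquiv.refl ℚ_[p] (k i)) x) = ∑ τ ∈ T, c τ * τ x := by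
  obtain ⟨ι⟩ := EmbeddingOrder.nonempty_algHom_padicAlgCl (p := p) (K := k i)
  refine ⟨ι, {ι}, fun _ => 1, fun τ _ => by simp, fun x => ?_⟩
  simp

/-- **Per-slot stability of `(R_I)^∼` in a MIXED packet.**  Let `g_i` be `ℚ_p`-linear isometries of arbitrary `p`-adic slot fields
`k_i` (`i ∈ I` finite, non-empty; the `k_i` need not coincide).  If at EVERY slot either `g_i` is the identity, or `k_i` is TAME
(`¬ ∀ x, ‖x‖ ≤ 1 → ‖Tr x‖ < 1`), or `k_i` lies on the RESIDUAL DYADIC CLASS (units `≡ 1`, a uniformizer `π`, some `‖x₀‖ ≤ ‖π‖⁻¹` with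
`‖Tr x₀‖ ≥ 1`), then `(⊗_i g_i)((R_I)^∼) = (R_I)^∼`.  The slot fields at the identity slots are unrestricted.
[cite: Mochizuki2012, IUTchIV Prop. 1.1 p. 9] [cite: SerreLocalFields1979, Ch. III §3, Prop. 7] -/
theorem congr_image_normalizedPacket_eq_of_refl_or_good
    (g : ∀ i, k i ≃ₗ[ℚ_[p]] k i) (hg : ∀ i x, ‖g i x‖ = ‖x‖)
    (hslot : ∀ i, g i = LinearEquiv.refl ℚ_[p] (k i) ∨
      (¬ ∀ x : k i, ‖x‖ ≤ 1 → ‖Algebra.trace ℚ_[p] (k i) x‖ < 1) ∨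
      ((∀ w : k i, ‖w‖ = 1 → ‖w - 1‖ < 1) ∧ ∃ π x₀ : k i, (∀ y : k i, ‖y‖ < 1 → ‖y‖ ≤ ‖π‖) ∧ ‖x₀‖ ≤ ‖π‖⁻¹ ∧
        1 ≤ ‖Algebra.trace ℚ_[p] (k i) x₀‖)) :
    (PiTensorProduct.congr g : PacketAlgebra p k ≃ₗ[ℚ_[p]] PacketAlgebra p k) ''
        (normalizedPacket p k : Set (PacketAlgebra p k)) = normalizedPacket p k := by
  have hg' : ∀ i x, ‖(g i).symm x‖ = ‖x‖ := fun i x => by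
    conv_rhs => rw [← (g i).apply_symm_apply x]
    rw [hg]
  have key : ∀ (i : I) (σ : k i ≃ₗ[ℚ_[p]] k i), (∀ x, ‖σ x‖ = ‖x‖) →
      (σ = LinearEquiv.refl ℚ_[p] (k i) ∨
        (¬ ∀ x : k i, ‖x‖ ≤ 1 → ‖Algebra.trace ℚ_[p] (k i) x‖ < 1) ∨
        ((∀ w : k i, ‖w‖ = 1 → ‖w - 1‖ < 1) ∧ ∃ π x₀ : k i, (∀ y : k i, ‖y‖ < 1 → ‖y‖ ≤ ‖π‖) ∧ ‖x₀‖ ≤ ‖π‖⁻¹ ∧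
          1 ≤ ‖Algebra.trace ℚ_[p] (k i) x₀‖)) →
      ∃ (ι : k i →ₐ[ℚ_[p]] PadicAlgCl p) (T : Finset (k i →ₐ[ℚ_[p]] PadicAlgCl p))
        (c : (k i →ₐ[ℚ_[p]] PadicAlgCl p) → PadicAlgCl p), (∀ τ ∈ T, ‖c τ‖ ≤ 1) ∧ ∀ x, ι (σ x) = ∑ τ ∈ T, c τ * τ x := by
    intro i σ hσ h
    rcases h with hrefl | htame | ⟨hres, π, x₀, hπmax, hx₀, htr₀⟩
    · subst hrefl
      exact exists_embeddingOrder_repr_refl p k i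
    · obtain ⟨ι⟩ := EmbeddingOrder.nonempty_algHom_padicAlgCl (p := p) (K := k i)
      exact ⟨ι, (EmbeddingOrder.exists_embeddingOrder_repr_of_isometry_of_not_wild htame σ hσ ι).1⟩
    · obtain ⟨ι⟩ := EmbeddingOrder.nonempty_algHom_padicAlgCl (p := p) (K := k i)
      exact ⟨ι, DyadicPrimeResidue.exists_embeddingOrder_repr_of_isometry hres π hπmax x₀ hx₀ htr₀ σ hσ ι⟩
  have hslot' : ∀ i, (g i).symm = LinearEquiv.refl ℚ_[p] (k i) ∨
      (¬ ∀ x : k i, ‖x‖ ≤ 1 → ‖Algebra.trace ℚ_[p] (k i) x‖ < 1) ∨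
      ((∀ w : k i, ‖w‖ = 1 → ‖w - 1‖ < 1) ∧ ∃ π x₀ : k i, (∀ y : k i, ‖y‖ < 1 → ‖y‖ ≤ ‖π‖) ∧ ‖x₀‖ ≤ ‖π‖⁻¹ ∧
        1 ≤ ‖Algebra.trace ℚ_[p] (k i) x₀‖) := by
    intro i
    rcases hslot i with hrefl | hrest
    · left
      rw [hrefl]
      rfl
    · exact Or.inr hrest
  exact EmbeddingOrder.congr_image_normalizedPacket_of_embeddingOrder p k g (fun i => key i (g i) (hg i) (hslot i))
    (fun i => key i (g i).symm (hg' i) (hslot' i))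

/-- **Good slots never move a mixed packet.**  Under the hypothesis of `congr_image_normalizedPacket_eq_of_refl_or_good` (every slot
at which `g` is not the identity is tame or residual dyadic — the other slot fields arbitrary) no `z ∈ (R_I)^∼` is moved out of
`(R_I)^∼` by `⊗_i g_i`.  Contrapositive reading: a factorwise-isometric MOVER of `(R_I)^∼` acts non-trivially at some slot whose
field is WILD and off the residual dyadic class. [cite: Mochizuki2012, IUTchIV Prop. 1.1 p. 9] -/
theorem not_exists_mover_at_refl_or_good
    (g : ∀ i, k i ≃ₗ[ℚ_[p]] k i) (hg : ∀ i x, ‖g i x‖ = ‖x‖)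
    (hslot : ∀ i, g i = LinearEquiv.refl ℚ_[p] (k i) ∨
      (¬ ∀ x : k i, ‖x‖ ≤ 1 → ‖Algebra.trace ℚ_[p] (k i) x‖ < 1) ∨
      ((∀ w : k i, ‖w‖ = 1 → ‖w - 1‖ < 1) ∧ ∃ π x₀ : k i, (∀ y : k i, ‖y‖ < 1 → ‖y‖ ≤ ‖π‖) ∧ ‖x₀‖ ≤ ‖π‖⁻¹ ∧
        1 ≤ ‖Algebra.trace ℚ_[p] (k i) x₀‖)) :
    ¬ ∃ z : PacketAlgebra p k, z ∈ normalizedPacket p k ∧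
        (PiTensorProduct.congr g : PacketAlgebra p k ≃ₗ[ℚ_[p]] PacketAlgebra p k) z ∉ normalizedPacket p k := by
  rintro ⟨z, hz, hmove⟩
  have himg := congr_image_normalizedPacket_eq_of_refl_or_good p k g hg hslot
  have hmem : (PiTensorProduct.congr g : PacketAlgebra p k ≃ₗ[ℚ_[p]] PacketAlgebra p k) z ∈
      (PiTensorProduct.congr g : PacketAlgebra p k ≃ₗ[ℚ_[p]] PacketAlgebra p k) ''
        (normalizedPacket p k : Set (PacketAlgebra p k)) := Set.mem_image_of_mem _ hz
  rw [himg] at hmem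
  exact hmove hmem

end MixedPacket

end Literature.IUT.LogVolume

end
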